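import Literature.Analysis.OperatorTheory.TwistedKernelTraceFormula

/-!
# Twisted spectral data: purity forces a flux-free top state and cheap twists (abstract and kernel level)

HELPER for the crux `BalabanLadder.IR` (stmt-QuantumFields-19354; ideator ym-ir-idea-9, lens «transfer»; `--supports` the crux, `--as
helper`; part 1 of 2, part 2 = `BalabanLadderIRTwistCostOfPurity`).  The abstract half of the workfile
`Cruxes/IR/Lines/flux_purity_square_seam.lean` (rev 4, fully proved; §1–§3 = its §1–§3 verbatim), composed in §4 with the kernel
lemmas of `Literature.Analysis.OperatorTheory.TwistedKernelTraceFormula` (ym-ir-lit-4 g2, p611637 — cited, not restated).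

HONEST FRAMING.  Transfer-matrix bookkeeping valid for every finite∕compact symmetry; nothing here proves the Yang–Mills mass gap
(Clay), a lattice gap, `BalabanLadder.IR` or its seed `BasinRung.ColdExitAt`; `R4` closes only the conditional finite-𝕋⁴ rung
`BalabanLadder.UV`.

* §1–§2 [TTF] `HasTwistedSpectralDatum` (finite abelian flux group `Zc`, complex characters) and `twist_cost_le_of_pure`:
  purity `1 − z₁(2t)/z₁(t)² ≤ θ < 1/2` ⇒ the top state is flux-free and every twist costs `≤ 2θ` at `t` and `2t`
  ('t Hooft 1979 (NPB 153) §§2, 4, 5; `Σ pᵢ² ≤ max pᵢ`; character dichotomy `χ ≡ 1 ∨ Σ χ = 0`).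
* §3 [TTF-ℝ] `HasRealTwistedSpectralDatum` (any index type with a distinguished `1`, real coefficients `|κᵢ(c)| ≤ 1`, top state
  flux-free by hypothesis) and `twist_cost_le_of_pure_real` — the form Perron–Frobenius delivers, ANY `θ`.
* §4 `hasRealTwistedSpectralDatum_of_kernel`, `twist_cost_le_of_pure_kernel`: a positive, positive-type symmetric bounded kernel with
  an eigenbasis and a family of `K`-invariant measure-preserving twists `T c` (`T 1 = id`) carries [TTF-ℝ] for its twisted cyclic
  kernel integrals (twisted trace formula + Cauchy–Schwarz + Jentzsch∕positivity improving, all from p611637).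
-/

set_option autoImplicit false

noncomputable section

open scoped BigOperators
open Finset

namespace Summit.QuantumFields.YangMills.Cruxes.IR.TwistCost

variable {Zc : Type} [CommGroup Zc] [Fintype Zc]

/-- [TTF] **Twisted spectral datum** for a family `z : Zc → ℕ → ℝ` of twisted traces (`z c τ = Tr (𝕋^τ Ĉ_c)`, `τ ≥ 2`): joint
eigenvalues `0 ≤ λᵢ ≤ λ_{i₀}`, `0 < λ_{i₀}`, unit multiplicative flux labels `χᵢ : Zc → ℂ`, the real trace formula for `c = 1` and the
complex twisted trace formula for every `c`. -/
def HasTwistedSpectralDatum (z : Zc → ℕ → ℝ) : Prop :=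
  ∃ (ι : Type) (lam : ι → ℝ) (i₀ : ι) (χ : ι → Zc → ℂ),
    (∀ i, 0 ≤ lam i ∧ lam i ≤ lam i₀) ∧ 0 < lam i₀ ∧
    (∀ i, χ i 1 = 1) ∧ (∀ i a b, χ i (a * b) = χ i a * χ i b) ∧ (∀ i a, ‖χ i a‖ = 1) ∧
    (∀ m : ℕ, HasSum (fun i => lam i ^ (m + 2)) (z 1 (m + 2))) ∧
    (∀ (c : Zc) (m : ℕ), HasSum (fun i => χ i c * ((lam i : ℂ) ^ (m + 2))) ((z c (m + 2) : ℝ) : ℂ))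

/-! ## §1 Two elementary lemmas: character dichotomy and a distance bound in `ℂ` -/

/-- A multiplicative `χ : Zc → ℂ` on a finite group is trivial or has vanishing average (reindex the sum by `c ↦ c₀ c`). -/
theorem char_trivial_or_sum_eq_zero (χ : Zc → ℂ) (hmul : ∀ a b, χ (a * b) = χ a * χ b) :
    (∀ c, χ c = 1) ∨ ∑ c, χ c = 0 := by
  by_cases h : ∀ c, χ c = 1
  · exact Or.inl h
  · right
    push Not at h
    obtain ⟨c₀, hc₀⟩ := h
    have hS : χ c₀ * ∑ c, χ c = ∑ c, χ c := by
      rw [Finset.mul_sum]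
      simp_rw [← hmul]
      exact Fintype.sum_equiv (Equiv.mulLeft c₀) _ _ (fun c => rfl)
    have h1 : (χ c₀ - 1) * ∑ c, χ c = 0 := by rw [sub_mul, one_mul, hS, sub_self]
    rcases mul_eq_zero.mp h1 with h2 | h2
    · exact absurd (sub_eq_zero.mp h2) hc₀
    · exact h2

/-- A non-trivial multiplicative unit-valued `χ` takes a value with non-positive real part. -/
theorem exists_re_nonpos (χ : Zc → ℂ) (hmul : ∀ a b, χ (a * b) = χ a * χ b) (hnt : ¬ ∀ c, χ c = 1) :
    ∃ c, (χ c).re ≤ 0 := by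
  rcases char_trivial_or_sum_eq_zero χ hmul with h | h
  · exact absurd h hnt
  · by_contra hne
    push Not at hne
    have hre : (∑ c, χ c).re = ∑ c, (χ c).re := by simp [Complex.re_sum]
    have hpos : 0 < ∑ c, (χ c).re :=
      Finset.sum_pos (fun c _ => hne c) ⟨1, Finset.mem_univ _⟩
    rw [← hre, h] at hpos
    simp at hpos

/-- If `x ≥ 0` is real, `‖w‖ = 1` and `Re w ≤ 0`, then `x` is at distance at least `L ≥ 0` from `w·L`. -/
theorem le_norm_real_sub_mul {x L : ℝ} {w : ℂ} (hx : 0 ≤ x) (hL : 0 ≤ L) (hw : ‖w‖ = 1) (hre : w.re ≤ 0) :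
    L ≤ ‖(x : ℂ) - w * (L : ℂ)‖ := by
  have hw2 : w.re * w.re + w.im * w.im = 1 := by
    rw [← Complex.normSq_apply, ← Complex.sq_norm, hw, one_pow]
  have hv : ‖(x : ℂ) - w * (L : ℂ)‖ ^ 2 = (x - w.re * L) * (x - w.re * L) + (w.im * L) * (w.im * L) := by
    rw [Complex.sq_norm, Complex.normSq_apply]
    simp [Complex.sub_re, Complex.sub_im, Complex.mul_re, Complex.mul_im]
  have hsq : L ^ 2 ≤ ‖(x : ℂ) - w * (L : ℂ)‖ ^ 2 := by
    rw [hv]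
    have h1 : 0 ≤ -(w.re * L) := by nlinarith
    nlinarith [mul_nonneg hx h1, mul_nonneg hx hx]
  exact (pow_le_pow_iff_left₀ hL (norm_nonneg _) two_ne_zero).mp hsq

/-! ## §2 The theorem -/

/-- **Purity ⇒ flux-free top state ⇒ every central twist is cheap, at BOTH times `t` and `2t` of the defect.**  In the class [TTF] with
non-negative twisted traces: `1 − z 1 (2t)/(z 1 t)² ≤ θ < 1/2` (`t = m+2`) implies `1 − z c t / z 1 t ≤ 2θ` and
`1 − z c (2t) / z 1 (2t) ≤ 2θ` for every twist `c`. -/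
theorem twist_cost_le_of_pure {z : Zc → ℕ → ℝ} (hD : HasTwistedSpectralDatum z) (hpos : ∀ c τ, 0 ≤ z c τ)
    {θ : ℝ} (hθ : θ < 1 / 2) (m : ℕ)
    (hpure : 1 - z 1 (2 * (m + 2)) / z 1 (m + 2) ^ 2 ≤ θ) (c : Zc) :
    1 - z c (m + 2) / z 1 (m + 2) ≤ 2 * θ ∧ 1 - z c (2 * (m + 2)) / z 1 (2 * (m + 2)) ≤ 2 * θ := by
  classical
  obtain ⟨ι, lam, i₀, χ, hle, hpos0, hχ1, hχmul, hχnorm, hreal, hcplx⟩ := hD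
  -- notation
  have h2t : 2 * m + 2 + 2 = 2 * (m + 2) := by ring
  set t : ℕ := m + 2 with ht
  set Z : ℝ := z 1 t with hZdef
  set Z' : ℝ := z 1 (2 * t) with hZ'def
  set L0 : ℝ := lam i₀ ^ t with hL0def
  -- the real trace formulas at `t` and `2t`
  have hsumZ : HasSum (fun i => lam i ^ t) Z := hreal m
  have hsumZ' : HasSum (fun i => lam i ^ (2 * t)) Z' := by
    have h := hreal (2 * m + 2); rwa [h2t] at h
  -- `L0 ≤ Z`, `0 < Z`, `L0² ≤ Z'`, `Z' ≤ L0 · Z`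
  have hL0_le : L0 ≤ Z := le_hasSum hsumZ i₀ fun j _ => pow_nonneg (hle j).1 _
  have hL0pos : 0 < L0 := pow_pos hpos0 _
  have hZpos : 0 < Z := lt_of_lt_of_le hL0pos hL0_le
  have hL0sq_le : L0 ^ 2 ≤ Z' := by
    have h : lam i₀ ^ (2 * t) ≤ Z' := le_hasSum hsumZ' i₀ fun j _ => pow_nonneg (hle j).1 _
    calc L0 ^ 2 = lam i₀ ^ (2 * t) := by rw [hL0def, ← pow_mul, mul_comm]
      _ ≤ Z' := h
  have hZ'_le : Z' ≤ L0 * Z := by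
    have h2 : HasSum (fun i => L0 * lam i ^ t) (L0 * Z) := hsumZ.mul_left _
    refine hasSum_le (fun i => ?_) hsumZ' h2
    calc lam i ^ (2 * t) = lam i ^ t * lam i ^ t := by rw [two_mul, pow_add]
      _ ≤ lam i₀ ^ t * lam i ^ t :=
          mul_le_mul_of_nonneg_right (pow_le_pow_left₀ (hle i).1 (hle i).2 t) (pow_nonneg (hle i).1 t)
  have hZ'pos : 0 < Z' := lt_of_lt_of_le (by positivity) hL0sq_le
  -- purity: `(1 - θ) Z² ≤ Z'`, hence `(1 - θ) Z ≤ L0`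
  have hp : (1 - θ) * Z ^ 2 ≤ Z' := by
    have h1 : 1 - θ ≤ Z' / Z ^ 2 := by linarith
    exact (le_div_iff₀ (by positivity)).mp h1
  have hR : (1 - θ) * Z ≤ L0 := by
    have h1 : (1 - θ) * Z * Z ≤ L0 * Z := by nlinarith [hp, hZ'_le]
    exact le_of_mul_le_mul_right h1 hZpos
  -- the twisted trace is within `Σ_{i ≠ i₀} λᵢ^τ` of `χ_{i₀}(c) λ_{i₀}^τ` (both times)
  have near_top : ∀ (c : Zc) (m' : ℕ),
      ‖((z c (m' + 2) : ℝ) : ℂ) - χ i₀ c * ((lam i₀ : ℂ) ^ (m' + 2))‖ ≤ z 1 (m' + 2) - lam i₀ ^ (m' + 2) := by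
    intro c m'
    have hs := hcplx c m'
    have hs0 : HasSum (fun i => if i = i₀ then χ i₀ c * ((lam i₀ : ℂ) ^ (m' + 2)) else 0)
        (χ i₀ c * ((lam i₀ : ℂ) ^ (m' + 2))) := hasSum_ite_eq i₀ _
    have hg0 : HasSum (fun i => if i = i₀ then lam i₀ ^ (m' + 2) else 0) (lam i₀ ^ (m' + 2)) := hasSum_ite_eq i₀ _
    refine HasSum.norm_le_of_bounded (hs.sub hs0) ((hreal m').sub hg0) (fun i => ?_)
    by_cases hi : i = i₀
    · subst hi; simp
    · simp only [hi, if_false, sub_zero]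
      rw [norm_mul, norm_pow, Complex.norm_real, Real.norm_of_nonneg (hle i).1, hχnorm, one_mul]
  -- the top state is flux-free: `χ_{i₀} = 1`
  have htriv : ∀ c', χ i₀ c' = 1 := by
    by_contra hnt
    obtain ⟨c₁, hc₁⟩ := exists_re_nonpos (χ i₀) (hχmul i₀) hnt
    have hlow : L0 ≤ ‖((z c₁ t : ℝ) : ℂ) - χ i₀ c₁ * ((lam i₀ : ℂ) ^ t)‖ := by
      have h := le_norm_real_sub_mul (hpos c₁ t) hL0pos.le (hχnorm i₀ c₁) hc₁
      have hc : ((L0 : ℝ) : ℂ) = (lam i₀ : ℂ) ^ t := by rw [hL0def]; push_cast; rfl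
      rwa [hc] at h
    have hup : ‖((z c₁ t : ℝ) : ℂ) - χ i₀ c₁ * ((lam i₀ : ℂ) ^ t)‖ ≤ Z - L0 := near_top c₁ m
    -- `L0 ≤ Z - L0`, `(1-θ) Z ≤ L0`, `θ < 1/2`, `Z > 0`: contradiction
    nlinarith [hlow.trans hup, hR, hθ, hZpos]
  -- conclusion at time `t`
  have hre_t : 2 * L0 - Z ≤ z c t := by
    have h := near_top c m
    rw [htriv c, one_mul] at h
    have hc : ((z c t : ℝ) : ℂ) - (lam i₀ : ℂ) ^ t = ((z c t - L0 : ℝ) : ℂ) := by rw [hL0def]; push_cast; rfl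
    rw [hc, Complex.norm_real, Real.norm_eq_abs] at h
    have h' := (abs_le.mp h).1
    linarith
  have hconc_t : 1 - z c t / Z ≤ 2 * θ := by
    have h1 : (1 - 2 * θ) * Z ≤ z c t := by nlinarith [hre_t, hR]
    have h2 : 1 - 2 * θ ≤ z c t / Z := (le_div_iff₀ hZpos).mpr h1
    linarith
  -- conclusion at time `2t`
  have hre_2t : 2 * L0 ^ 2 - Z' ≤ z c (2 * t) := by
    have h := near_top c (2 * m + 2)
    rw [h2t, htriv c, one_mul] at h
    have hc : ((z c (2 * t) : ℝ) : ℂ) - (lam i₀ : ℂ) ^ (2 * t) = ((z c (2 * t) - L0 ^ 2 : ℝ) : ℂ) := by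
      rw [hL0def, ← pow_mul, mul_comm t 2]; push_cast; rfl
    have hL2 : lam i₀ ^ (2 * t) = L0 ^ 2 := by rw [hL0def, ← pow_mul, mul_comm]
    rw [hc, Complex.norm_real, Real.norm_eq_abs, hL2] at h
    have h' := (abs_le.mp h).1
    linarith
  have hconc_2t : 1 - z c (2 * t) / Z' ≤ 2 * θ := by
    -- `(1-θ) Z' ≤ (1-θ) L0 Z ≤ L0²`, so `z c (2t) ≥ 2 L0² - Z' ≥ (1 - 2θ) Z'`
    have h0 : (1 - θ) * Z' ≤ L0 ^ 2 := by
      have h01 : (1 - θ) * Z' ≤ (1 - θ) * (L0 * Z) := mul_le_mul_of_nonneg_left hZ'_le (by linarith)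
      nlinarith [h01, hR, hL0pos.le]
    have h1 : (1 - 2 * θ) * Z' ≤ z c (2 * t) := by nlinarith [hre_2t, h0]
    have h2 : 1 - 2 * θ ≤ z c (2 * t) / Z' := (le_div_iff₀ hZ'pos).mpr h1
    linarith
  exact ⟨hconc_t, hconc_2t⟩

/-! ## §3 The REAL form the Wilson theory actually delivers (Perron–Frobenius makes the top state flux-free for free)

On the Wilson side the eigenbasis of `exists_spectralData_wilsonFinTorusPartition_box` is a REAL Hilbert basis `bᵢ` of `L²` of the slice,
the temporal twist by a central `c` is the substitution operator `Ĉ_c` of a measure-preserving «large gauge transformation» of the slice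
(orthogonal, positivity-preserving, commuting with the transfer operator `𝕋` because `c` is central), so the twisted trace is
`Tr(𝕋^τ Ĉ_c) = Σᵢ λᵢ^τ κᵢ(c)` with the REAL coefficients `κᵢ(c) = ⟨bᵢ, Ĉ_c bᵢ⟩ ∈ [−1, 1]` — and `κ_{i₀}(c) = 1` with NO purity input,
because the top eigenvalue of the positivity-improving `𝕋` is simple with a positive eigenvector `ψ₀` (Jentzsch, in the tree's proof) and
`Ĉ_c ψ₀` is again a positive top eigenvector, hence `= ψ₀` ('t Hooft: the finite-volume ground state carries no electric flux).  In that
form the theorem needs neither `θ < 1/2` nor the sign of the twisted traces.  Discharging `HasRealTwistedSpectralDatum` for idea-10's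
`twistedColdZ` = (i) `Lp.compMeasurePreserving` for `Ĉ_c`, (ii) `K(Cx, Cy) = K(x, y)` for `finTorusSliceKernel`, (iii) the twisted variant of
`hasSum_pow_integral_cyclic` (one `Ĉ` inserted in the cyclic kernel product), (iv) simplicity of the top eigenvalue, (v) the time-slicing
identity for the twisted box (variant of `wilsonFinTorusPartition_eq_integral_prod_finTorusSliceKernel_succ`).  Items (i)–(iv) are DONE at
the kernel level in §4 below (`hasRealTwistedSpectralDatum_of_kernel`, with the substitution `x ↦ T x` in place of the operator `Ĉ`, so that
no `Lp.compMeasurePreserving` bookkeeping is needed); (v) and the two located model facts (measure preservation of `T_c`, `T_c`-invariance of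
the slice kernel) are what a typer supplies as the hypotheses `hT`, `hKT`, `hz` of `twist_cost_le_of_pure_kernel`. -/

/-- [TTF-ℝ] **Real twisted spectral datum**: `z 1 (m+2) = Σ λᵢ^{m+2}`, `z c (m+2) = Σ κᵢ(c) λᵢ^{m+2}` with `|κᵢ(c)| ≤ 1` and a
twist-invariant top state `κ_{i₀}(c) = 1`. -/
def HasRealTwistedSpectralDatum {Tw : Type} [One Tw] (z : Tw → ℕ → ℝ) : Prop :=
  ∃ (ι : Type) (lam : ι → ℝ) (i₀ : ι) (κ : ι → Tw → ℝ),
    (∀ i, 0 ≤ lam i ∧ lam i ≤ lam i₀) ∧ 0 < lam i₀ ∧ (∀ i c, |κ i c| ≤ 1) ∧ (∀ c, κ i₀ c = 1) ∧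
    (∀ m : ℕ, HasSum (fun i => lam i ^ (m + 2)) (z 1 (m + 2))) ∧
    (∀ (c : Tw) (m : ℕ), HasSum (fun i => κ i c * lam i ^ (m + 2)) (z c (m + 2)))

omit [CommGroup Zc] [Fintype Zc] in
/-- **Purity ⇒ every twist is cheap (real form, any `θ`, any index type of twists with a distinguished untwisted `1`).**  In the class [TTF-ℝ]: `1 − z 1 (2t)/(z 1 t)² ≤ θ` (`t = m+2`) implies
`1 − z c t / z 1 t ≤ 2θ` and `1 − z c (2t) / z 1 (2t) ≤ 2θ` for every twist `c`. -/
theorem twist_cost_le_of_pure_real {Tw : Type} [One Tw] {z : Tw → ℕ → ℝ} (hD : HasRealTwistedSpectralDatum z)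
    {θ : ℝ} (m : ℕ) (hpure : 1 - z 1 (2 * (m + 2)) / z 1 (m + 2) ^ 2 ≤ θ) (c : Tw) :
    1 - z c (m + 2) / z 1 (m + 2) ≤ 2 * θ ∧ 1 - z c (2 * (m + 2)) / z 1 (2 * (m + 2)) ≤ 2 * θ := by
  classical
  obtain ⟨ι, lam, i₀, κ, hle, hpos0, hκ, hκ0, hreal, htw⟩ := hD
  have h2t : 2 * m + 2 + 2 = 2 * (m + 2) := by ring
  set t : ℕ := m + 2 with ht
  set Z : ℝ := z 1 t with hZdef
  set Z' : ℝ := z 1 (2 * t) with hZ'def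
  set L0 : ℝ := lam i₀ ^ t with hL0def
  have hsumZ : HasSum (fun i => lam i ^ t) Z := hreal m
  have hsumZ' : HasSum (fun i => lam i ^ (2 * t)) Z' := by
    have h := hreal (2 * m + 2); rwa [h2t] at h
  have hL0_le : L0 ≤ Z := le_hasSum hsumZ i₀ fun j _ => pow_nonneg (hle j).1 _
  have hL0pos : 0 < L0 := pow_pos hpos0 _
  have hZpos : 0 < Z := lt_of_lt_of_le hL0pos hL0_le
  have hL0sq_le : L0 ^ 2 ≤ Z' := by
    have h : lam i₀ ^ (2 * t) ≤ Z' := le_hasSum hsumZ' i₀ fun j _ => pow_nonneg (hle j).1 _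
    calc L0 ^ 2 = lam i₀ ^ (2 * t) := by rw [hL0def, ← pow_mul, mul_comm]
      _ ≤ Z' := h
  have hZ'_le : Z' ≤ L0 * Z := by
    have h2 : HasSum (fun i => L0 * lam i ^ t) (L0 * Z) := hsumZ.mul_left _
    refine hasSum_le (fun i => ?_) hsumZ' h2
    calc lam i ^ (2 * t) = lam i ^ t * lam i ^ t := by rw [two_mul, pow_add]
      _ ≤ lam i₀ ^ t * lam i ^ t :=
          mul_le_mul_of_nonneg_right (pow_le_pow_left₀ (hle i).1 (hle i).2 t) (pow_nonneg (hle i).1 t)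
  have hZ'pos : 0 < Z' := lt_of_lt_of_le (by positivity) hL0sq_le
  have hp : (1 - θ) * Z ^ 2 ≤ Z' := by
    have h1 : 1 - θ ≤ Z' / Z ^ 2 := by linarith
    exact (le_div_iff₀ (by positivity)).mp h1
  have hR : (1 - θ) * Z ≤ L0 := by
    have h1 : (1 - θ) * Z * Z ≤ L0 * Z := by nlinarith [hp, hZ'_le]
    exact le_of_mul_le_mul_right h1 hZpos
  -- the twisted trace is within `Σ_{i ≠ i₀} λᵢ^τ` of `λ_{i₀}^τ`
  have near_top : ∀ m' : ℕ, |z c (m' + 2) - lam i₀ ^ (m' + 2)| ≤ z 1 (m' + 2) - lam i₀ ^ (m' + 2) := by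
    intro m'
    have hs := htw c m'
    have hs0 : HasSum (fun i => if i = i₀ then κ i₀ c * lam i₀ ^ (m' + 2) else 0) (κ i₀ c * lam i₀ ^ (m' + 2)) :=
      hasSum_ite_eq i₀ _
    have hg0 : HasSum (fun i => if i = i₀ then lam i₀ ^ (m' + 2) else 0) (lam i₀ ^ (m' + 2)) := hasSum_ite_eq i₀ _
    have h := HasSum.norm_le_of_bounded (hs.sub hs0) ((hreal m').sub hg0) (fun i => ?_)
    · rwa [hκ0 c, one_mul, Real.norm_eq_abs] at h
    by_cases hi : i = i₀
    · subst hi; simp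
    · simp only [hi, if_false, sub_zero]
      rw [norm_mul, Real.norm_eq_abs, Real.norm_of_nonneg (pow_nonneg (hle i).1 _)]
      calc |κ i c| * lam i ^ (m' + 2) ≤ 1 * lam i ^ (m' + 2) :=
            mul_le_mul_of_nonneg_right (hκ i c) (pow_nonneg (hle i).1 _)
        _ = lam i ^ (m' + 2) := one_mul _
  have hre_t : 2 * L0 - Z ≤ z c t := by
    have h' := (abs_le.mp (near_top m)).1
    linarith
  have hconc_t : 1 - z c t / Z ≤ 2 * θ := by
    have h1 : (1 - 2 * θ) * Z ≤ z c t := by nlinarith [hre_t, hR]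
    have h2 : 1 - 2 * θ ≤ z c t / Z := (le_div_iff₀ hZpos).mpr h1
    linarith
  have hre_2t : 2 * L0 ^ 2 - Z' ≤ z c (2 * t) := by
    have h := near_top (2 * m + 2)
    have hL2 : lam i₀ ^ (2 * t) = L0 ^ 2 := by rw [hL0def, ← pow_mul, mul_comm]
    rw [h2t, hL2] at h
    have h' := (abs_le.mp h).1
    linarith
  have hconc_2t : 1 - z c (2 * t) / Z' ≤ 2 * θ := by
    have h0 : (1 - θ) * Z' ≤ L0 ^ 2 := by
      by_cases hθ1 : θ ≤ 1
      · have h01 : (1 - θ) * Z' ≤ (1 - θ) * (L0 * Z) := mul_le_mul_of_nonneg_left hZ'_le (by linarith)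
        nlinarith [h01, hR, hL0pos.le]
      · push Not at hθ1
        nlinarith [hZ'pos, sq_nonneg L0]
    have h1 : (1 - 2 * θ) * Z' ≤ z c (2 * t) := by nlinarith [hre_2t, h0]
    have h2 : 1 - 2 * θ ≤ z c (2 * t) / Z' := (le_div_iff₀ hZ'pos).mpr h1
    linarith
  exact ⟨hconc_t, hconc_2t⟩

/-! ## §4 Kernel level: composition with the twisted trace formula of `Literature.Analysis.OperatorTheory.TwistedKernelTraceFormula`

The operator-theoretic lemmas — the twisted trace formula `hasSum_pow_integral_iterate_twisted`, the Cauchy–Schwarz bound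
`abs_integral_twisted_coeff_le` (`|κᵢ(c)| ≤ 1`), the Perron–Frobenius flux-freeness of the top state `integral_twisted_coeff_top`
(`κ_{i₀}(c) = 1` for a `K`-invariant measure-preserving twist) and `integral_iterate_twisted_le` (`Z^{tw} ≤ Z`) — are CITED from
lit-4's `Literature/Analysis/OperatorTheory/TwistedKernelTraceFormula.lean` (p611637), not restated.  What remains here is the
composition: a positive, positive-type symmetric bounded kernel with an eigenbasis and a family of `K`-invariant measure-preserving
twists `T c` (`T 1 = id`) carries a `HasRealTwistedSpectralDatum` for the twisted cyclic kernel integrals, hence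
`twist_cost_le_of_pure_kernel`.
-/

section Kernel

open MeasureTheory Filter Set Function
open scoped RealInnerProductSpace ENNReal
open Literature.Analysis.OperatorTheory

variable {X : Type} [MeasurableSpace X] {μ : Measure X} [IsFiniteMeasure μ]
  {K : X → X → ℝ} {C : ℝ} {A : Lp ℝ 2 μ →L[ℝ] Lp ℝ 2 μ} {ι : Type}
  {b : HilbertBasis ι ℝ (Lp ℝ 2 μ)} {lam : ι → ℝ}

omit [CommGroup Zc] [Fintype Zc] in
/-- **The kernel-level twisted spectral datum** (discharge of `[TTF-ℝ]` modulo time-slicing).  For a positive,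
positive-type (`λᵢ ≥ 0`) symmetric bounded kernel with top index `i₀` (`λ_{i₀} = ‖A‖ ≠ 0`) and a family of
measure-preserving `K`-invariant twists `T c` (`c : Tw`, `T 1 = id`), ANY family of numbers `z c τ` that agrees
at `τ = m+2` with the twisted cyclic kernel integrals `∫ (κ^{[m+1]} K(·,x))(T c x) dμ(x)` carries a
`HasRealTwistedSpectralDatum` (with `κ i c = ∫ (κbᵢ)∘(T c) · κbᵢ dμ / λᵢ²`). -/
theorem hasRealTwistedSpectralDatum_of_kernel [Countable ι] {Tw : Type} [One Tw]
    (hK : StronglyMeasurable (uncurry K)) (hC : ∀ x y, ‖K x y‖ ≤ C)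
    (hsymm : ∀ x y, K x y = K y x) (hKpos : ∀ x y, 0 < K x y)
    (hA : ∀ φ : Lp ℝ 2 μ, (A φ : X → ℝ) =ᵐ[μ] fun x => ∫ y, K x y * φ y ∂μ)
    (hb : ∀ i, A (b i) = lam i • b i) (hlam : ∀ i, 0 ≤ lam i) {i₀ : ι} (hi₀ : lam i₀ = ‖A‖)
    (hlam₀ : lam i₀ ≠ 0) (T : Tw → X → X) (hT1 : T 1 = id) (hT : ∀ c, MeasurePreserving (T c) μ μ)
    (hKT : ∀ c x y, K (T c x) (T c y) = K x y) {z : Tw → ℕ → ℝ}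
    (hz : ∀ c m, z c (m + 2) =
      ∫ x, ((fun f : X → ℝ => fun w => ∫ y, K w y * f y ∂μ)^[m + 1] (fun y => K y x)) (T c x) ∂μ) :
    HasRealTwistedSpectralDatum z := by
  have hlam₀pos : 0 < lam i₀ := lt_of_le_of_ne (hlam i₀) (Ne.symm hlam₀)
  refine ⟨ι, lam, i₀, fun i c => if lam i = 0 then 1 else
      (∫ x, (∫ y, K (T c x) y * b i y ∂μ) * (∫ y, K x y * b i y ∂μ) ∂μ) / lam i ^ 2,
    fun i => ⟨hlam i, ?_⟩, hlam₀pos, fun i c => ?_, fun c => ?_, fun m => ?_, fun c m => ?_⟩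
  · -- `λᵢ ≤ λ_{i₀} = ‖A‖`
    rw [hi₀]
    exact (le_abs_self _).trans (abs_lam_le_norm hb i)
  · -- `|κ i c| ≤ 1`
    dsimp only
    by_cases h : lam i = 0
    · rw [if_pos h, abs_one]
    · rw [if_neg h, abs_div, abs_of_nonneg (sq_nonneg (lam i)),
        div_le_one (pow_pos (lt_of_le_of_ne (hlam i) (Ne.symm h)) 2)]
      exact abs_integral_twisted_coeff_le hK hC hA hb (hT c) i
  · -- `κ i₀ c = 1`
    dsimp only
    rw [if_neg hlam₀, integral_twisted_coeff_top hK hC hsymm hKpos hA hb (hT c) (hKT c) hi₀ hlam₀,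
      div_self (pow_ne_zero 2 hlam₀)]
  · -- untwisted trace formula
    have hAm := hasSum_pow_integral_iterate_twisted hK hC hsymm hA hb (hT 1).measurable m
    have hfun : (fun i => lam i ^ m *
        ∫ x, (∫ y, K (T 1 x) y * b i y ∂μ) * (∫ y, K x y * b i y ∂μ) ∂μ) = fun i => lam i ^ (m + 2) := by
      funext i
      rw [hT1]
      simp only [id_eq]
      have h2 : ∫ x, (∫ y, K x y * b i y ∂μ) * (∫ y, K x y * b i y ∂μ) ∂μ = lam i ^ 2 := by
        rw [← integral_sq_integral_kernel_mul_basis hK hC hA hb i]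
        exact integral_congr_ae (Eventually.of_forall fun x => by ring)
      rw [h2, ← pow_add]
    rw [hfun] at hAm
    rwa [hz 1 m]
  · -- twisted trace formula
    have hAm := hasSum_pow_integral_iterate_twisted hK hC hsymm hA hb (hT c).measurable m
    rw [hz c m]
    convert hAm using 1
    funext i
    dsimp only
    by_cases h : lam i = 0
    · have hI := abs_integral_twisted_coeff_le hK hC hA hb (hT c) i
      rw [h] at hI
      have hI0 : ∫ x, (∫ y, K (T c x) y * b i y ∂μ) * (∫ y, K x y * b i y ∂μ) ∂μ = 0 :=
        abs_nonpos_iff.1 (by simpa using hI)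
      rw [if_pos h, h, hI0]
      simp
    · rw [if_neg h]
      field_simp
      ring

omit [CommGroup Zc] [Fintype Zc] in
/-- **Purity ⇒ every twist is cheap, kernel level.**  Under the hypotheses of
`hasRealTwistedSpectralDatum_of_kernel`: if the untwisted traces are pure at `(t, 2t)`, `t = m+2`
(`1 - z 1 (2t) / (z 1 t)² ≤ θ`), then EVERY twist costs at most `2θ` at times `t` and `2t`. -/
theorem twist_cost_le_of_pure_kernel [Countable ι] {Tw : Type} [One Tw]
    (hK : StronglyMeasurable (uncurry K)) (hC : ∀ x y, ‖K x y‖ ≤ C)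
    (hsymm : ∀ x y, K x y = K y x) (hKpos : ∀ x y, 0 < K x y)
    (hA : ∀ φ : Lp ℝ 2 μ, (A φ : X → ℝ) =ᵐ[μ] fun x => ∫ y, K x y * φ y ∂μ)
    (hb : ∀ i, A (b i) = lam i • b i) (hlam : ∀ i, 0 ≤ lam i) {i₀ : ι} (hi₀ : lam i₀ = ‖A‖)
    (hlam₀ : lam i₀ ≠ 0) (T : Tw → X → X) (hT1 : T 1 = id) (hT : ∀ c, MeasurePreserving (T c) μ μ)
    (hKT : ∀ c x y, K (T c x) (T c y) = K x y) {z : Tw → ℕ → ℝ}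
    (hz : ∀ c m, z c (m + 2) =
      ∫ x, ((fun f : X → ℝ => fun w => ∫ y, K w y * f y ∂μ)^[m + 1] (fun y => K y x)) (T c x) ∂μ)
    {θ : ℝ} (m : ℕ) (hpure : 1 - z 1 (2 * (m + 2)) / z 1 (m + 2) ^ 2 ≤ θ) (c : Tw) :
    1 - z c (m + 2) / z 1 (m + 2) ≤ 2 * θ ∧ 1 - z c (2 * (m + 2)) / z 1 (2 * (m + 2)) ≤ 2 * θ :=
  twist_cost_le_of_pure_real
    (hasRealTwistedSpectralDatum_of_kernel hK hC hsymm hKpos hA hb hlam hi₀ hlam₀ T hT1 hT hKT hz) m hpure c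

end Kernel

end Summit.QuantumFields.YangMills.Cruxes.IR.TwistCost

end
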